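import Mathlib
import Summits.NavierStokesRegularity.NavierStokesRegularity.Theorems.SubOnsagerCeilingDefs
import Summits.NavierStokesRegularity.NavierStokesRegularity.Theorems.SubOnsagerCeilingKPPumpLadderChain
import HarnessLib

/-!
# The crux and its registered stubs are ONE currency: `ForwardTailCeilingKP` ⇒ the primary graded barrier for
# every table ⇒ the ν-uniform super-critical barrier for the Katz–Pavlović chain at every ratio `(1+ε₀)^{1/4}`
(helper file for the crux `SubOnsagerCeiling.ForwardTailCeilingKP`, stmt-NavierStokesRegularity-27057, `--supports`;
hand leafhand-ns-subonsagerceiling-4 gen 4)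

The LEAD skeleton `Cruxes/ForwardTailCeilingKP/Lines/kp_shell_barrier.lean` (v19) closes the crux from the two registered
stubs `stub_primaryGradedLargeRatio` / `stub_primaryGradedSmallRatio`, i.e. from `PrimaryGradedAt R ε₀ α` for every KP
network proper (`fwdCeilingKPAt_of_primaryGraded`, by LEAD SE's graded assembly `fwdCeilingKP_of_gradedEnvelope`).
This file records the CONVERSE, which was missing from the tree:

* `kpPrimaryGraded_of_fwdCeilingKPAt` — for ONE table at ONE ratio, the per-table body `FwdCeilingKPAt R ε₀ α` of the
  crux (a forward-source set `S ⊇ S⁺(α)`, `θ > 1/2`, `C ≥ 0` before `ν`, tail sums `Σ_{k=n..N} Σ_{i∈S} ½X² ≤ C·E₀·b^{-2θn}`)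
  IMPLIES the body of `PrimaryGradedAt R ε₀ α` (verbatim, skeleton v6–v19): grade the modes by `lev i = 0` on `S` and
  `lev i = 1` off `S`; a mode of level `≠ 0` lies outside `S`, hence has NO forward feed (`α i j l (0,0,1) = 0`), so the
  structural clauses `GradedStruct α lev` — which only speak about forward sources of level `≠ 0` — hold vacuously;
  the level-0 modes are the modes of `S`, and the one-term window `N = n = k` of the tail sum bounds each of their
  (non-negative) shell energies: `(1+ε₀)^{2θ'k}·½X_{i,k}(t)² ≤ C·E₀` with `θ' = min θ 1 ∈ (1/2, 1]`.
* `kpPrimaryGraded_of_forwardTailCeilingKP` — hence the ROUTE DECL `ForwardTailCeilingKP` implies the primary graded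
  barrier for EVERY `R ≥ 1`, EVERY `ε₀ ∈ (0, 1]` and EVERY table: restricted to `1/4 < ε₀ ≤ 1` resp. `0 < ε₀ ≤ 1/4`
  this is VERBATIM `Sig.stub_primaryGradedLargeRatio` resp. `Sig.stub_primaryGradedSmallRatio` of the skeleton.
  READING: together with the skeleton's `ForwardTailCeilingKP_of` the registered line is LOSSLESS — the two stubs are
  jointly EQUIVALENT to the crux (kernel-checked in both directions); no re-cut of the stubs can be easier than the
  crux itself, and every weakening of the stubs is a weakening of the crux.
* `kpChainBarrier_of_forwardTailCeilingKP` — composed with hand 4-g1's `pumpLadder_quarterRatioChain_barrier`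
  (p826110: the tuned in-shell pump ladder of `E₂(8)` IS the positive Katz–Pavlović chain at ratio `(1+ε₀)^{1/4}`):
  the CRUX ITSELF (not only its stubs) implies, for every `ε₀ ∈ (0, 1]`, the ν-uniform super-critical weighted barrier
  `θ ∈ (1/2, 1]` for every honest non-negative solution of the viscous Katz–Pavlović chain at the scale ratio
  `B = (1+ε₀)^{1/4} ∈ (1, 2^{1/4}]` (on a residue class of sites mod 4) — the λ-UNIFORM Barbato–Morandin–Romito /
  Cheskidov–Zaya problem, in print at one ratio only, in the regime `B ≈ 1.10` where the measured front exponent of the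
  chain is `θ_f ≈ 0.60` (hands 4-g0/4-g1/4-g2) and no certified region exists (LEAD census v15: certificates end at
  `B = 1.36`).

HONEST FRAMING: bookkeeping about Tao-type MODEL lattice ODEs (route SubOnsagerCeiling, rung TL-M2Break); no stub,
crux or summit is proved and nothing here bears on Navier–Stokes regularity.
[cite: Tao2016AveragedNS, §4 (4.13)] [cite: BarbatoMorandinRomito2011, §3.2 (shape of the barrier)]
-/

noncomputable section

-- the sub-problem namespace `NavierStokesRegularity.NavierStokesRegularity` is the tree's layout (D-0017)
set_option linter.dupNamespace false

namespace Summit.NavierStokesRegularity.NavierStokesRegularity.Theorems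

open Set Finset
open Literature.Analysis.FluidPDE.TaoCascade
open Summit.NavierStokesRegularity.NavierStokesRegularity.Theses.SubOnsagerCeiling

variable {α : Fin 4 → Fin 4 → Fin 4 → ℤ × ℤ × ℤ → ℝ}

/-- **KP forward-source tail ceiling ⇒ the primary graded barrier, per table** (the converse of the skeleton's
`fwdCeilingKPAt_of_primaryGraded`): from a forward-source set `S ⊇ S⁺(α)` with the tail ceiling take the grading
`lev = 0` on `S`, `lev = 1` off `S` (`L = 1`); modes of level `≠ 0` have no forward feed, so the structural clauses are
vacuous; the level-0 modes are those of `S` and the one-term window `N = n = k` of the tail sum gives their weighted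
shell barrier with `θ' = min θ 1`, `D = C`. [cite: Tao2016AveragedNS, §4 (4.13)] -/
theorem kpPrimaryGraded_of_fwdCeilingKPAt {R ε₀ : ℝ} (hε : 0 < ε₀)
    (h : Literature.Analysis.FluidPDE.TaoCascade.InTableClass R α → (∀ (Y : Fin 4 → ℤ → ℝ → ℝ) (τ : ℝ), (∀ (j : Fin 4) (k : ℤ), 1 ≤ k → 0 ≤ Y j k τ) → ∀ δ : ℝ, 0 < δ → ∀ (i : Fin 4) (n : ℤ), 1 ≤ n → Y i n τ = 0 → 0 ≤ Literature.Analysis.FluidPDE.TaoCascade.quadTerm δ α Y i n τ) → (∀ a b i : Fin 4, a ≠ b → α a b i (0, 0, 1) = 0) → ∃ S : Finset (Fin 4), (∀ i, i ∉ S → ∀ j l : Fin 4, α i j l (0, 0, 1) = 0) ∧ ∃ θ : ℝ, 1 / 2 < θ ∧ ∃ C : ℝ, 0 ≤ C ∧ ∀ ν : ℝ, 0 < ν → ∀ (X₀ : Fin 4 → ℝ) (s : ℝ), 0 < s → ∀ X : Fin 4 → ℤ → ℝ → ℝ, (∀ (i : Fin 4) (k : ℤ), X i k 0 = if k = 0 then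 X₀ i else 0) → (∀ (i : Fin 4) (k : ℤ), k < 0 → ∀ t : ℝ, X i k t = 0) → (∃ M : ℝ, ∀ (t : ℝ) (i : Fin 4) (k : ℤ), (1 + (1 + ε₀) ^ ((10 : ℝ) * k)) * |X i k t| ≤ M) → (∀ (i : Fin 4) (k : ℤ), Continuous (X i k)) → (∀ (i : Fin 4) (k : ℤ), ∀ t ∈ Set.Icc (0 : ℝ) s, HasDerivWithinAt (X i k) (Literature.Analysis.FluidPDE.TaoCascade.quadTerm ε₀ α X i k t - ν * (1 + ε₀) ^ ((2 : ℝ) * k) * X i k t) (Set.Icc (0 : ℝ) s) t) → (∀ t ∈ Set.Icc (0 : ℝ) s, ∀ (i : Fin 4) (k : ℤ), 1 ≤ k → 0 ≤ X i k t) → ∀ n N : ℕ, n ≤ N → ∀ t ∈ Set.Icc (0 : ℝ) s, ∑ k ∈ Finset.Icc n N, ∑ i ∈ S, (1 / 2 : ℝ) * X i (k : ℤ) t ^ 2 ≤ C * (∑ i : Fin 4, (1 / 2 : ℝ) * X₀ i ^ 2) * (1 + ε₀) ^ (-(2 * θ * (n : ℝ)))) :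
    Literature.Analysis.FluidPDE.TaoCascade.InTableClass R α →
      (∀ (Y : Fin 4 → ℤ → ℝ → ℝ) (τ : ℝ), (∀ (j : Fin 4) (k : ℤ), 1 ≤ k → 0 ≤ Y j k τ) → ∀ δ : ℝ, 0 < δ →
        ∀ (i : Fin 4) (n : ℤ), 1 ≤ n → Y i n τ = 0 → 0 ≤ Literature.Analysis.FluidPDE.TaoCascade.quadTerm δ α Y i n τ) →
      (∀ a b i : Fin 4, a ≠ b → α a b i (0, 0, 1) = 0) →
      ∃ (lev : Fin 4 → ℕ) (L : ℕ), (∀ a, lev a ≤ L) ∧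
        (∀ a, lev a ≠ 0 → (∃ e, α a a e (0, 0, 1) ≠ 0) →
          (∀ j, α j j a (0, 0, 1) ≠ 0 → lev j < lev a ∧ (lev j = 0 ∨ ∃ e', α j j e' (0, 0, 1) ≠ 0)) ∧
          (∀ i₁ i₂, i₁ ≠ a → i₂ ≠ a → α i₁ i₂ a (0, 0, 0) ≠ 0 →
            (lev i₁ < lev a ∧ (lev i₁ = 0 ∨ ∃ e', α i₁ i₁ e' (0, 0, 1) ≠ 0)) ∧
            (lev i₂ < lev a ∧ (lev i₂ = 0 ∨ ∃ e', α i₂ i₂ e' (0, 0, 1) ≠ 0))) ∧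
          (∃ e, α a a e (0, 0, 1) ≠ 0 ∧
            (∀ j, α e e j (0, 0, 1) ≠ 0 → lev j < lev a ∧ (lev j = 0 ∨ ∃ e', α j j e' (0, 0, 1) ≠ 0)) ∧
            (∀ j, j ≠ e → α e e j (0, 0, 0) ≠ 0 →
              lev j < lev a ∧ (lev j = 0 ∨ ∃ e', α j j e' (0, 0, 1) ≠ 0)))) ∧
        ∃ θ : ℝ, 1 / 2 < θ ∧ θ ≤ 1 ∧ ∃ D : ℝ, 0 ≤ D ∧
          ∀ ν : ℝ, 0 < ν → ∀ (X₀ : Fin 4 → ℝ) (s : ℝ), 0 < s → ∀ X : Fin 4 → ℤ → ℝ → ℝ,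
          (∀ (i : Fin 4) (k : ℤ), X i k 0 = if k = 0 then X₀ i else 0) →
          (∀ (i : Fin 4) (k : ℤ), k < 0 → ∀ t : ℝ, X i k t = 0) →
          (∃ M : ℝ, ∀ (t : ℝ) (i : Fin 4) (k : ℤ), (1 + (1 + ε₀) ^ ((10 : ℝ) * k)) * |X i k t| ≤ M) →
          (∀ (i : Fin 4) (k : ℤ), Continuous (X i k)) →
          (∀ (i : Fin 4) (k : ℤ), ∀ t ∈ Set.Icc (0 : ℝ) s, HasDerivWithinAt (X i k)
            (Literature.Analysis.FluidPDE.TaoCascade.quadTerm ε₀ α X i k t - ν * (1 + ε₀) ^ ((2 : ℝ) * k) * X i k t)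
            (Set.Icc (0 : ℝ) s) t) →
          (∀ t ∈ Set.Icc (0 : ℝ) s, ∀ (i : Fin 4) (k : ℤ), 1 ≤ k → 0 ≤ X i k t) →
          ∀ t ∈ Set.Icc (0 : ℝ) s, ∀ i, lev i = 0 → ∀ k : ℕ,
            (1 + ε₀) ^ (2 * θ * (k : ℝ)) * ((1 / 2 : ℝ) * X i (k : ℤ) t ^ 2) ≤
              D * (∑ j : Fin 4, (1 / 2 : ℝ) * X₀ j ^ 2) := by
  intro hT hO hD
  obtain ⟨S, hS, θ, hθ, C, hC, H⟩ := h hT hO hD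
  refine ⟨fun i => if i ∈ S then 0 else 1, 1, fun a => ?_, fun a ha hsrc => ?_, min θ 1,
    lt_min hθ (by norm_num), min_le_right θ 1, C, hC, ?_⟩
  · -- levels are `≤ 1`
    show (if a ∈ S then 0 else 1) ≤ 1
    split_ifs <;> norm_num
  · -- structural clauses are vacuous: a mode of level `≠ 0` lies outside `S`, hence is no forward source
    exfalso
    have haS : a ∉ S := by
      intro haS
      apply ha
      show (if a ∈ S then 0 else 1) = 0
      rw [if_pos haS]
    obtain ⟨e, he⟩ := hsrc
    exact he (hS a haS a e)
  · -- the barrier of the level-0 modes (= the modes of `S`) from the one-term window of the tail sum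
    intro ν hν X₀ s hs X hX0 hXneg hM hXc hXd hXpos t ht i hi k
    have hiS : i ∈ S := by
      by_contra hiS
      apply one_ne_zero (α := ℕ)
      have : (if i ∈ S then 0 else 1) = 0 := hi
      rwa [if_neg hiS] at this
    have key := H ν hν X₀ s hs X hX0 hXneg hM hXc hXd hXpos k k le_rfl t ht
    rw [Finset.Icc_self, Finset.sum_singleton] at key
    have hsingle : (1 / 2 : ℝ) * X i (k : ℤ) t ^ 2 ≤ ∑ j ∈ S, (1 / 2 : ℝ) * X j (k : ℤ) t ^ 2 :=
      Finset.single_le_sum (f := fun j => (1 / 2 : ℝ) * X j (k : ℤ) t ^ 2) (fun j _ => by positivity) hiS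
    have hb : (0 : ℝ) < 1 + ε₀ := by linarith
    have hb1 : (1 : ℝ) ≤ 1 + ε₀ := by linarith
    have hw : (0 : ℝ) < (1 + ε₀) ^ (2 * θ * (k : ℝ)) := Real.rpow_pos_of_pos hb _
    have hneg : (1 + ε₀) ^ (-(2 * θ * (k : ℝ))) = ((1 + ε₀) ^ (2 * θ * (k : ℝ)))⁻¹ := Real.rpow_neg hb.le _
    rw [hneg] at key
    have hmono : (1 + ε₀) ^ (2 * min θ 1 * (k : ℝ)) ≤ (1 + ε₀) ^ (2 * θ * (k : ℝ)) :=
      Real.rpow_le_rpow_of_exponent_le hb1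
        (mul_le_mul_of_nonneg_right (by linarith [min_le_left θ 1]) (Nat.cast_nonneg k))
    calc (1 + ε₀) ^ (2 * min θ 1 * (k : ℝ)) * ((1 / 2 : ℝ) * X i (k : ℤ) t ^ 2)
        ≤ (1 + ε₀) ^ (2 * θ * (k : ℝ)) * ((1 / 2 : ℝ) * X i (k : ℤ) t ^ 2) :=
          mul_le_mul_of_nonneg_right hmono (by positivity)
      _ ≤ (1 + ε₀) ^ (2 * θ * (k : ℝ)) * (C * (∑ j : Fin 4, (1 / 2 : ℝ) * X₀ j ^ 2) *
            ((1 + ε₀) ^ (2 * θ * (k : ℝ)))⁻¹) :=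
          mul_le_mul_of_nonneg_left (hsingle.trans key) hw.le
      _ = C * (∑ j : Fin 4, (1 / 2 : ℝ) * X₀ j ^ 2) := by
          field_simp

/-- **The ROUTE DECL `ForwardTailCeilingKP` implies the primary graded barrier for every table at every spread
`R ≥ 1` and every ratio `ε₀ ∈ (0, 1]`** — restricted to `1/4 < ε₀ ≤ 1` resp. `0 < ε₀ ≤ 1/4` this is verbatim the
registered stub `Sig.stub_primaryGradedLargeRatio` resp. `Sig.stub_primaryGradedSmallRatio` of the skeleton
`Cruxes/ForwardTailCeilingKP/Lines/kp_shell_barrier.lean` (v19): together with the skeleton's `ForwardTailCeilingKP_of`,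
the stubs are jointly EQUIVALENT to the crux (the line is lossless). Bookkeeping; no stub is proved.
[cite: Tao2016AveragedNS, §4 (4.13)] -/
theorem kpPrimaryGraded_of_forwardTailCeilingKP (h : ForwardTailCeilingKP) :
    ∀ R : ℝ, 1 ≤ R → ∀ ε₀ : ℝ, 0 < ε₀ → ε₀ ≤ 1 → ∀ α : Fin 4 → Fin 4 → Fin 4 → ℤ × ℤ × ℤ → ℝ,
    Literature.Analysis.FluidPDE.TaoCascade.InTableClass R α →
      (∀ (Y : Fin 4 → ℤ → ℝ → ℝ) (τ : ℝ), (∀ (j : Fin 4) (k : ℤ), 1 ≤ k → 0 ≤ Y j k τ) → ∀ δ : ℝ, 0 < δ →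
        ∀ (i : Fin 4) (n : ℤ), 1 ≤ n → Y i n τ = 0 → 0 ≤ Literature.Analysis.FluidPDE.TaoCascade.quadTerm δ α Y i n τ) →
      (∀ a b i : Fin 4, a ≠ b → α a b i (0, 0, 1) = 0) →
      ∃ (lev : Fin 4 → ℕ) (L : ℕ), (∀ a, lev a ≤ L) ∧
        (∀ a, lev a ≠ 0 → (∃ e, α a a e (0, 0, 1) ≠ 0) →
          (∀ j, α j j a (0, 0, 1) ≠ 0 → lev j < lev a ∧ (lev j = 0 ∨ ∃ e', α j j e' (0, 0, 1) ≠ 0)) ∧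
          (∀ i₁ i₂, i₁ ≠ a → i₂ ≠ a → α i₁ i₂ a (0, 0, 0) ≠ 0 →
            (lev i₁ < lev a ∧ (lev i₁ = 0 ∨ ∃ e', α i₁ i₁ e' (0, 0, 1) ≠ 0)) ∧
            (lev i₂ < lev a ∧ (lev i₂ = 0 ∨ ∃ e', α i₂ i₂ e' (0, 0, 1) ≠ 0))) ∧
          (∃ e, α a a e (0, 0, 1) ≠ 0 ∧
            (∀ j, α e e j (0, 0, 1) ≠ 0 → lev j < lev a ∧ (lev j = 0 ∨ ∃ e', α j j e' (0, 0, 1) ≠ 0)) ∧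
            (∀ j, j ≠ e → α e e j (0, 0, 0) ≠ 0 →
              lev j < lev a ∧ (lev j = 0 ∨ ∃ e', α j j e' (0, 0, 1) ≠ 0)))) ∧
        ∃ θ : ℝ, 1 / 2 < θ ∧ θ ≤ 1 ∧ ∃ D : ℝ, 0 ≤ D ∧
          ∀ ν : ℝ, 0 < ν → ∀ (X₀ : Fin 4 → ℝ) (s : ℝ), 0 < s → ∀ X : Fin 4 → ℤ → ℝ → ℝ,
          (∀ (i : Fin 4) (k : ℤ), X i k 0 = if k = 0 then X₀ i else 0) →
          (∀ (i : Fin 4) (k : ℤ), k < 0 → ∀ t : ℝ, X i k t = 0) →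
          (∃ M : ℝ, ∀ (t : ℝ) (i : Fin 4) (k : ℤ), (1 + (1 + ε₀) ^ ((10 : ℝ) * k)) * |X i k t| ≤ M) →
          (∀ (i : Fin 4) (k : ℤ), Continuous (X i k)) →
          (∀ (i : Fin 4) (k : ℤ), ∀ t ∈ Set.Icc (0 : ℝ) s, HasDerivWithinAt (X i k)
            (Literature.Analysis.FluidPDE.TaoCascade.quadTerm ε₀ α X i k t - ν * (1 + ε₀) ^ ((2 : ℝ) * k) * X i k t)
            (Set.Icc (0 : ℝ) s) t) →
          (∀ t ∈ Set.Icc (0 : ℝ) s, ∀ (i : Fin 4) (k : ℤ), 1 ≤ k → 0 ≤ X i k t) →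
          ∀ t ∈ Set.Icc (0 : ℝ) s, ∀ i, lev i = 0 → ∀ k : ℕ,
            (1 + ε₀) ^ (2 * θ * (k : ℝ)) * ((1 / 2 : ℝ) * X i (k : ℤ) t ^ 2) ≤
              D * (∑ j : Fin 4, (1 / 2 : ℝ) * X₀ j ^ 2) :=
  fun R hR ε₀ h0 h1 α => kpPrimaryGraded_of_fwdCeilingKPAt h0 (h R hR ε₀ h0 h1 α)

/-- **THE CRUX CONTAINS THE λ-UNIFORM KATZ–PAVLOVIĆ CHAIN BARRIER** (composition with hand 4-g1's
`pumpLadder_quarterRatioChain_barrier`, the tuned in-shell pump ladder of `E₂(8)`): if `ForwardTailCeilingKP` holds then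
for every `ε₀ ∈ (0, 1]` there are a residue `j ∈ {2, 3}`, `θ ∈ (1/2, 1]` and `D ≥ 0` such that, uniformly in `ν > 0`,
every honest solution `Z : ℤ → ℝ → ℝ` on `[0, s]` of the positive viscous Katz–Pavlović chain at the scale ratio
`B = (1+ε₀)^{1/4}` (bond coefficients `C m = (1+ε₀)^{-15/8}·B^{5m/2}`, viscosity `ν(1+ε₀)^{2⌊m/4⌋}`, equations written by
residue of the site `m (mod 4)`) from the one-site datum `A·1_{m=0}` obeys
`(1+ε₀)^{2θk}·½Z_{4k+j}(t)² ≤ D·½A²` for all `t ∈ [0, s]`, `k ≥ 0`. READING: the crux as typed implies the ν-uniform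
super-critical barrier for the chain at every `B ∈ (1, 2^{1/4}]`, which is in print at one ratio only. MODEL lattice
bookkeeping; nothing is proved about the crux. [cite: BarbatoMorandinRomito2011, §3.2 (shape of the barrier)]
[cite: Tao2016AveragedNS, §4 (4.13)] -/
theorem kpChainBarrier_of_forwardTailCeilingKP (h : ForwardTailCeilingKP) {ε₀ : ℝ} (hε : 0 < ε₀) (hε1 : ε₀ ≤ 1) :
    ∃ j : ℕ, (j = 2 ∨ j = 3) ∧ ∃ θ : ℝ, 1 / 2 < θ ∧ θ ≤ 1 ∧ ∃ D : ℝ, 0 ≤ D ∧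
      ∀ ν : ℝ, 0 < ν → ∀ (A s : ℝ), 0 < s → ∀ (C : ℤ → ℝ),
      (∀ m : ℤ, C m = (1 + ε₀) ^ (-((15 : ℝ) / 8)) * ((1 + ε₀) ^ ((1 : ℝ) / 4)) ^ ((5 : ℝ) * (m : ℝ) / 2)) →
      ∀ Z : ℤ → ℝ → ℝ,
      (∀ m : ℤ, Z m 0 = if m = 0 then A else 0) →
      (∀ m : ℤ, m < 0 → ∀ t : ℝ, Z m t = 0) →
      (∃ M : ℝ, ∀ (t : ℝ) (m : ℤ), (1 + (1 + ε₀) ^ ((10 : ℝ) * ((m / 4 : ℤ) : ℝ))) * |Z m t| ≤ M) →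
      (∀ m : ℤ, Continuous (Z m)) →
      (∀ k : ℤ, ∀ t ∈ Set.Icc (0 : ℝ) s, HasDerivWithinAt (Z (4 * k))
        (C (4 * (k - 1) + 3) * Z (4 * (k - 1) + 3) t ^ 2 - C (4 * k) * (Z (4 * k) t * Z (4 * k + 1) t) -
          ν * (1 + ε₀) ^ ((2 : ℝ) * k) * Z (4 * k) t) (Set.Icc (0 : ℝ) s) t) →
      (∀ k : ℤ, ∀ t ∈ Set.Icc (0 : ℝ) s, HasDerivWithinAt (Z (4 * k + 1))
        (C (4 * k) * Z (4 * k) t ^ 2 - C (4 * k + 1) * (Z (4 * k + 1) t * Z (4 * k + 2) t) -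
          ν * (1 + ε₀) ^ ((2 : ℝ) * k) * Z (4 * k + 1) t) (Set.Icc (0 : ℝ) s) t) →
      (∀ k : ℤ, ∀ t ∈ Set.Icc (0 : ℝ) s, HasDerivWithinAt (Z (4 * k + 2))
        (C (4 * k + 1) * Z (4 * k + 1) t ^ 2 - C (4 * k + 2) * (Z (4 * k + 2) t * Z (4 * k + 3) t) -
          ν * (1 + ε₀) ^ ((2 : ℝ) * k) * Z (4 * k + 2) t) (Set.Icc (0 : ℝ) s) t) →
      (∀ k : ℤ, ∀ t ∈ Set.Icc (0 : ℝ) s, HasDerivWithinAt (Z (4 * k + 3))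
        (C (4 * k + 2) * Z (4 * k + 2) t ^ 2 - C (4 * k + 3) * (Z (4 * k + 3) t * Z (4 * (k + 1)) t) -
          ν * (1 + ε₀) ^ ((2 : ℝ) * k) * Z (4 * k + 3) t) (Set.Icc (0 : ℝ) s) t) →
      (∀ t ∈ Set.Icc (0 : ℝ) s, ∀ m : ℤ, 4 ≤ m → 0 ≤ Z m t) →
      ∀ t ∈ Set.Icc (0 : ℝ) s, ∀ k : ℕ,
        (1 + ε₀) ^ (2 * θ * (k : ℝ)) * ((1 / 2 : ℝ) * Z (4 * (k : ℤ) + j) t ^ 2) ≤ D * ((1 / 2 : ℝ) * A ^ 2) :=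
  pumpLadder_quarterRatioChain_barrier hε hε1
    (fun α => kpPrimaryGraded_of_forwardTailCeilingKP h 8 (by norm_num) ε₀ hε hε1 α)

end Summit.NavierStokesRegularity.NavierStokesRegularity.Theorems

end
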